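import Summits.CriticalPhenomena.CardyFormulaZ2.Theses.CardyFlipRusso

/-!
# Route `CardyFlipRusso`, assembly item `Assembly` (stmt-CriticalPhenomena-10328) — proved

The assembly declaration
`Summit.CriticalPhenomena.CardyFormulaZ2.Theses.CardyFlipRusso.Assembly` is the implication

  SmirnovCardyTri → VoronoiHubFromSmirnov → SquareFromVoronoiHub → CoveringLeg →
  DiscretisationBridge → CardyFormulaZ2.

It is pure logic over its named hypotheses: Smirnov's theorem (`SmirnovCardyTri`, site-`𝕋`
Cardy) fed through `VoronoiHubFromSmirnov` gives Cardy for annealed Poisson–Voronoi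
percolation; `SquareFromVoronoiHub` turns that into Cardy for site percolation at `1/2` on the
centred square lattice `G_s` (crude discretisation); `CoveringLeg` gives Cardy for the crude
embedded bond-`ℤ²` crossing event `embDomainCrossing squareLatticeEmbedding.z`; and
`DiscretisationBridge`, rectangle by rectangle, upgrades the crude event to G02's
`bondDomainCrossingProb`, whose Cardy limit in every conformal rectangle is, by definition,
`CardyFormulaZ2` (`Literature.Probability.Percolation.CardyFormulaZ2`).

No analytic or probabilistic content is used; the mathematics of the route lives in the
hypotheses (cruxes `VoronoiHubFromSmirnov` 6433, `SquareFromVoronoiHub` 6434, `CoveringLeg`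
6435; support `SmirnovCardyTri` 6432 — proved in tree — and the shared `DiscretisationBridge`
0787).
-/

namespace Summit.CriticalPhenomena.CardyFormulaZ2.Theorems

/-- The assembly item `Assembly` of route `CardyFlipRusso` (stmt-CriticalPhenomena-10328):
Smirnov's theorem, the two Delaunay-flip transfer cruxes (site-`𝕋` → annealed Poisson–Voronoi →
site percolation on the centred square lattice `G_s`), the covering-lattice leg (site-`G_s` →
crude bond-`ℤ²` event) and the discretisation bridge on `ℤ²` together yield Cardy's formula for
bond percolation on `ℤ²` at `p = 1/2`. Proof: composition of the hypotheses (pure logic),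
`fun hS hHub hSq hCov hB R ↦ hB R (hCov (hSq (hHub hS)) R)`. -/
theorem cardyFlipRusso_assembly_proof :
    Summit.CriticalPhenomena.CardyFormulaZ2.Theses.CardyFlipRusso.Assembly := by
  unfold Summit.CriticalPhenomena.CardyFormulaZ2.Theses.CardyFlipRusso.Assembly
  intro hS hHub hSq hCov hB R
  -- Smirnov → Poisson–Voronoi → site-`G_s` → crude bond-ℤ² event → G02 event on `R`.
  exact hB R (hCov (hSq (hHub hS)) R)

end Summit.CriticalPhenomena.CardyFormulaZ2.Theorems
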